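import Summits.Ventures.HSemireg.WedgeHankelRecurrenceGaussReversedRecurrence

/-!
# Venture HSemireg — **NEWTON'S METHOD FROM THE RIGHT FOR THE LARGEST ZERO**: for `P = ∏ (X − z_i)` with distinct real zeros and `x` to the right of all of them, `P(x) > 0`, `P'(x) > 0` and
# `(x − z_m) P'(x) ≥ P(x)` for EVERY zero `z_m` (strictly if there are at least two zeros); hence the Newton iterate `x − P(x)∕P'(x)` stays `≥ z_m` (in particular right of the largest zero) and is
# `< x` — the iteration decreases monotonically and never overshoots; stated also for increasingly listed zeros (as for `q_{t+1}` of a positive recurrence)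

HONEST FRAMING. Part of the Lean index of the computation cell `pub-hsemireg` (seat p10 gen 44, Sunday typer «UNIFORM-IN-n»).  Real polynomials (`Polynomial.derivative`) and finite sums ∕ products
only; no limit is taken (only the one-step invariant is typed); no variety, no cohomology theory, no sheaf, no Ext group and no semiregularity map is constructed here; nothing here says that
HC / HC_CM / HC_AV holds; no Literature fact (unproved `Prop`) is declared or used.  Custodian versions as in `WedgeHankelSiegelIdeal` (1/3).
SOURCES (cited).  J. Stoer, R. Bulirsch, *Introduction to Numerical Analysis* (3rd ed.) Thm 5.5.5 ∕ §5.5 (for a polynomial with only real zeros, Newton's method started right of the largest zero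
converges monotonically to it); A. M. Ostrowski, *Solution of Equations and Systems of Equations* (1966) Ch. 9; J. H. Wilkinson, *Rounding Errors in Algebraic Processes* (1963) Ch. 2 §7.
PROOF TYPED HERE.  `P' = Σ_i ∏_{j≠i}(X − z_j)` (N334); right of the zeros every summand is positive and the `m`-th summand times `(x − z_m)` is `P(x)`, so `(x − z_m)P'(x) − P(x)` is the
(non-negative, resp. positive) sum of the other summands times `(x − z_m)`.
DEDUP DISCLOSURE (`rg -n -i 'newton' Summits/Ventures/HSemireg`, 2026-09-03): N298 ∕ N312 concern Newton SUMS of the zeros (power sums), unrelated; no Newton-iteration statement in the chapter.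
The 4 names below: 0 hits tree-wide.

WHAT IS IN THE TREE.  N334 `derivative_prod_X_sub_C_eq_sum`; N337 `eval_prod_X_sub_C_pos_of_gt`; N279 `recurrence_zeros_interlace`.
THIS FILE (namespace `Summit.Ventures.HSemireg.Wedge.HankelOuter` continued; CHAINED on N338 (import only); 0 definitions):
* §1104 `eval_derivative_prod_pos_of_gt` (`P'(x) > 0` right of the zeros), **`sub_zero_mul_derivative_ge`** (`P(x) ≤ (x − z_m)·P'(x)`, with `<` when `n ≥ 1`), **`newton_step_mem`**
  (`z_m ≤ x − P(x)∕P'(x) < x` for every `m`, strict lower bound when `n ≥ 1`), **`newton_step_of_strictMono_zeros`** (the same for a polynomial with increasingly listed zeros, e.g. `q_{t+1}` of a positive recurrence, N279).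
CAVEATS.  Distinct real zeros; the starting point strictly right of all zeros.  Nothing Ext-side.  New names only.
-/

open Module Polynomial
open scoped Matrix Polynomial

namespace Summit.Ventures.HSemireg.Wedge.HankelOuter

/-! ## §1104. The Newton step from the right -/

/-- **`P'(x) > 0` to the right of the zeros** (`P = ∏ (X − z_i)`, `n ≥ 1` factors). [this file, §1104] -/
theorem eval_derivative_prod_pos_of_gt {n : ℕ} {z : Fin (n + 1) → ℝ} {x : ℝ} (hx : ∀ i, z i < x) :
    0 < (derivative (∏ i, (Polynomial.X - C (z i)))).eval x := by
  rw [derivative_prod_X_sub_C_eq_sum, eval_finsetSum]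
  refine Finset.sum_pos (fun i _ => ?_) Finset.univ_nonempty
  rw [eval_prod]
  exact Finset.prod_pos fun j _ => by rw [eval_sub, eval_X, eval_C]; exact sub_pos.2 (hx j)

/-- **`P(x) ≤ (x − z_m) P'(x)` for every zero `z_m`, to the right of the zeros; strictly when there are at least two zeros.** [Stoer–Bulirsch §5.5; this file, §1104] -/
theorem sub_zero_mul_derivative_ge {n : ℕ} {z : Fin (n + 1) → ℝ} {x : ℝ} (hx : ∀ i, z i < x) (m : Fin (n + 1)) :
    (∏ i, (Polynomial.X - C (z i))).eval x ≤ (x - z m) * (derivative (∏ i, (Polynomial.X - C (z i)))).eval x ∧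
      (1 ≤ n → (∏ i, (Polynomial.X - C (z i))).eval x < (x - z m) * (derivative (∏ i, (Polynomial.X - C (z i)))).eval x) := by
  have hfac : ∀ j, (Polynomial.X - C (z j)).eval x = x - z j := fun j => by rw [eval_sub, eval_X, eval_C]
  have hterm_nonneg : ∀ i, 0 ≤ (∏ j ∈ Finset.univ.erase i, (Polynomial.X - C (z j))).eval x := fun i => by
    rw [eval_prod]; exact Finset.prod_nonneg fun j _ => by rw [hfac]; exact (sub_pos.2 (hx j)).le
  have hterm_pos : ∀ i, 0 < (∏ j ∈ Finset.univ.erase i, (Polynomial.X - C (z j))).eval x := fun i => by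
    rw [eval_prod]; exact Finset.prod_pos fun j _ => by rw [hfac]; exact sub_pos.2 (hx j)
  -- `(x − z_m) · (m-th summand) = P(x)`
  have hPm : (∏ i, (Polynomial.X - C (z i))).eval x = (x - z m) * (∏ j ∈ Finset.univ.erase m, (Polynomial.X - C (z j))).eval x := by
    rw [← Finset.mul_prod_erase Finset.univ (fun i => Polynomial.X - C (z i)) (Finset.mem_univ m), eval_mul, hfac]
  rw [derivative_prod_X_sub_C_eq_sum, eval_finsetSum, ← Finset.add_sum_erase Finset.univ _ (Finset.mem_univ m), mul_add, ← hPm]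
  have hxm : 0 < x - z m := sub_pos.2 (hx m)
  refine ⟨le_add_of_nonneg_right (mul_nonneg hxm.le (Finset.sum_nonneg fun i _ => hterm_nonneg i)), fun hn => lt_add_of_pos_right _ (mul_pos hxm ?_)⟩
  -- with at least two zeros the remaining sum has a (positive) term
  have hne : (Finset.univ.erase m : Finset (Fin (n + 1))).Nonempty := by
    rw [← Finset.card_pos, Finset.card_erase_of_mem (Finset.mem_univ m), Finset.card_univ, Fintype.card_fin]; omega
  exact Finset.sum_pos (fun i _ => hterm_pos i) hne

/-- **THE NEWTON STEP FROM THE RIGHT NEVER OVERSHOOTS: `z_m ≤ x − P(x)∕P'(x) < x` for every zero `z_m`** (strictly `z_m <` when `n ≥ 1`). [Stoer–Bulirsch Thm 5.5.5; Ostrowski Ch. 9; this file,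
§1104] -/
theorem newton_step_mem {n : ℕ} {z : Fin (n + 1) → ℝ} {x : ℝ} (hx : ∀ i, z i < x) (m : Fin (n + 1)) :
    z m ≤ x - (∏ i, (Polynomial.X - C (z i))).eval x / (derivative (∏ i, (Polynomial.X - C (z i)))).eval x ∧
      x - (∏ i, (Polynomial.X - C (z i))).eval x / (derivative (∏ i, (Polynomial.X - C (z i)))).eval x < x ∧
      (1 ≤ n → z m < x - (∏ i, (Polynomial.X - C (z i))).eval x / (derivative (∏ i, (Polynomial.X - C (z i)))).eval x) := by
  have hP' := eval_derivative_prod_pos_of_gt hx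
  have hP : 0 < (∏ i, (Polynomial.X - C (z i))).eval x := eval_prod_X_sub_C_pos_of_gt hx
  obtain ⟨hle, hlt⟩ := sub_zero_mul_derivative_ge hx m
  refine ⟨?_, by linarith [div_pos hP hP'], fun hn => ?_⟩
  · rw [le_sub_comm, div_le_iff₀ hP']; linarith
  · rw [lt_sub_comm, div_lt_iff₀ hP']; linarith [hlt hn]

/-- **NEWTON FROM THE RIGHT FOR A POLYNOMIAL WITH INCREASINGLY LISTED ZEROS** (e.g. `q_{t+1} = ∏ (X − x_j)` of a positive recurrence, N279): for `ξ > x_t`, `x_t ≤ ξ − P(ξ)∕P'(ξ) < ξ`,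
strictly `x_t <` when `t ≥ 1`. [Stoer–Bulirsch §5.5; this file, §1104] -/
theorem newton_step_of_strictMono_zeros {P : ℝ[X]} {t : ℕ} {x : Fin (t + 1) → ℝ} (hx : StrictMono x) (hP : P = ∏ j, (Polynomial.X - C (x j))) {ξ : ℝ} (hξ : x (Fin.last t) < ξ) :
    x (Fin.last t) ≤ ξ - P.eval ξ / (derivative P).eval ξ ∧ ξ - P.eval ξ / (derivative P).eval ξ < ξ ∧ (1 ≤ t → x (Fin.last t) < ξ - P.eval ξ / (derivative P).eval ξ) := by
  have hall : ∀ i, x i < ξ := fun i => (hx.monotone (Fin.le_last i)).trans_lt hξ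
  rw [hP]
  exact newton_step_mem hall (Fin.last t)

end Summit.Ventures.HSemireg.Wedge.HankelOuter
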